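import Summits.ValiantsHypothesis.ValiantsHypothesis.Theorems.SymPencilHessianRankSymmDet

/-!
# Route `SymPencil` — the abstract symmetric rank bound relative to the kernel-row map
# (tool for the cruxes `SdcPerSq` stmt-ValiantsHypothesis-5675 / `SdcPerBeyondN` stmt-5676)

Sharp form of the tree's abstract symmetric Mignon–Ressayre bound
(`Summit.ValiantsHypothesis.Theorems.rank_transpose_mul_mul_le_card_add_one`, whose proof is
adapted verbatim): for a bilinear form `H` on flattened `ι × ι` matrices killing the pairs
`(Z, Z')` with `wᵀ Z = 0`, `Z w = 0`, `wᵀ Z' w = 0`, and `L` with symmetric columns,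

  `rank (Lᵀ H L) ≤ rank (P_w L) + 1`,

where `P_w` flattens `Z ↦ wᵀ Z` (so `P_w L` is the matrix of the KERNEL-ROW MAP `y ↦ wᵀ M(y)`).
The tree's bound `|ι| + 1` is the trivial estimate `rank (P_w L) ≤ |ι|`; the point of the sharp
form is that for homogeneous determinants the kernel-row map is never onto
(`SymPencilHomogeneousHessianRank.lean`). [folklore]
-/

noncomputable section

-- single-conjunct layout: Sub = Summit, duplicated namespace component intended
set_option linter.dupNamespace false

namespace Summit.ValiantsHypothesis.ValiantsHypothesis.Theorems.SymPencilKernelRowRank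

open Matrix MvPolynomial
open Literature.Computability.AlgebraicComplexity

universe u

variable {k : Type u} [Field k]

/-! ### The abstract rank bound, relative to the kernel-row map -/

section Abstract

variable {ι : Type*} [Fintype ι] [DecidableEq ι]

/-- **Abstract symmetric rank bound, sharp form** (adapted from the tree's
`Summit.ValiantsHypothesis.Theorems.rank_transpose_mul_mul_le_card_add_one`, same proof): with
`H`, `w`, `L` as there, `rank (Lᵀ H L) ≤ rank (P_w L) + 1`, where `P_w` flattens `Z ↦ wᵀ Z`; the
tree's bound `|ι| + 1` is the case `rank (P_w L) ≤ |ι|`. [folklore] -/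
theorem rank_transpose_mul_mul_le_rank_add_one (H : Matrix (ι × ι) (ι × ι) k) (w : ι → k)
    (hw : w ≠ 0)
    (hH : ∀ Z Z' : ι × ι → k, w ᵥ* (Matrix.of fun i j => Z (i, j)) = 0 →
      (Matrix.of fun i j => Z (i, j)) *ᵥ w = 0 →
      w ⬝ᵥ (Matrix.of fun i j => Z' (i, j)) *ᵥ w = 0 → Z ⬝ᵥ H *ᵥ Z' = 0)
    {σ : Type*} [Fintype σ] (L : Matrix (ι × ι) σ k) (hL : ∀ i j v, L (i, j) v = L (j, i) v) :
    (Lᵀ * H * L).rank ≤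
      ((Matrix.of fun (j : ι) (q : ι × ι) => if q.2 = j then w q.1 else 0) * L).rank + 1 := by
  -- adapted from Summits/ValiantsHypothesis/ValiantsHypothesis/Theorems/SymPencilHessianRankSymmDet.lean
  obtain ⟨i₀, hi₀⟩ : ∃ i, w i ≠ 0 := Function.ne_iff.mp hw
  obtain ⟨i₀, hi₀⟩ : ∃ i, w i ≠ 0 := Function.ne_iff.mp hw
  set c : k := (w i₀)⁻¹ with hc
  have hcw : w i₀ * c = 1 := mul_inv_cancel₀ hi₀
  -- `P` flattens `Z ↦ wᵀ Z`; `R = S * P` is the symmetric row/column replacement map.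
  set P : Matrix ι (ι × ι) k := Matrix.of fun j q => if q.2 = j then w q.1 else 0 with hP
  set S : Matrix (ι × ι) ι k := Matrix.of fun p l =>
    (if p.1 = i₀ ∧ l = p.2 then c else 0) + (if p.2 = i₀ ∧ l = p.1 then c else 0) -
      (if p.1 = i₀ ∧ p.2 = i₀ then c ^ 2 * w l else 0) with hS
  set R : Matrix (ι × ι) (ι × ι) k := S * P with hR
  have hPZ : ∀ Z : ι × ι → k, P *ᵥ Z = w ᵥ* (Matrix.of fun i j => Z (i, j)) := by
    intro Z
    ext j
    simp only [hP, mulVec, dotProduct, of_apply, vecMul, ite_mul, zero_mul]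
    rw [Fintype.sum_prod_type]
    simp only [Finset.sum_ite_eq', Finset.mem_univ, if_true]
  have hRZ : ∀ Z : ι × ι → k, R *ᵥ Z = fun p =>
      (if p.1 = i₀ then c * (w ᵥ* Matrix.of fun i j => Z (i, j)) p.2 else 0) +
      (if p.2 = i₀ then c * (w ᵥ* Matrix.of fun i j => Z (i, j)) p.1 else 0) -
      (if p.1 = i₀ ∧ p.2 = i₀ then
        c ^ 2 * ((w ᵥ* Matrix.of fun i j => Z (i, j)) ⬝ᵥ w) else 0) := by
    intro Z
    rw [hR, ← mulVec_mulVec, hPZ]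
    set r := w ᵥ* Matrix.of fun i j => Z (i, j) with hr
    ext p
    simp only [hS, mulVec, dotProduct, of_apply, add_mul, sub_mul, Finset.sum_add_distrib,
      Finset.sum_sub_distrib, ite_mul, zero_mul]
    congr 2
    · by_cases h : p.1 = i₀
      · simp [h]
      · simp [h]
    · by_cases h : p.2 = i₀
      · simp [h]
      · simp [h]
    · by_cases h : p.1 = i₀ ∧ p.2 = i₀
      · simp only [h, and_self, if_true, Finset.mul_sum, mul_assoc, mul_comm (w _) (r _)]
      · simp [h]
  -- `R Z` is symmetric for every `Z`
  have hRsymm : ∀ (Z : ι × ι → k) (i j : ι), (R *ᵥ Z) (j, i) = (R *ᵥ Z) (i, j) := by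
    intro Z i j
    rw [hRZ]
    by_cases hi : i = i₀ <;> by_cases hj : j = i₀ <;> simp [hi, hj]
  -- `wᵀ (R Z) = wᵀ Z`
  have hRw : ∀ Z : ι × ι → k,
      w ᵥ* (Matrix.of fun i j => (R *ᵥ Z) (i, j)) = w ᵥ* Matrix.of fun i j => Z (i, j) := by
    intro Z
    ext j
    rw [hRZ]
    set r := w ᵥ* Matrix.of fun i j => Z (i, j) with hr
    rcases eq_or_ne j i₀ with rfl | hj
    · simp only [vecMul, dotProduct, of_apply, and_true, mul_add, mul_sub,
        Finset.sum_add_distrib, Finset.sum_sub_distrib, mul_ite, mul_zero, Finset.sum_ite_eq',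
        Finset.mem_univ, if_true]
      have e1 : ∑ i, w i * (c * r i) = c * ∑ i, r i * w i := by
        rw [Finset.mul_sum]
        exact Finset.sum_congr rfl fun i _ => by ring
      rw [e1]
      linear_combination (r j - c * ∑ i, r i * w i) * hcw
    · simp only [vecMul, dotProduct, of_apply, hj, if_false, and_false, mul_ite, mul_zero,
        add_zero, sub_zero, Finset.sum_ite_eq', Finset.mem_univ, if_true]
      rw [← mul_assoc, hcw, one_mul]
  clear_value R
  -- the fixed matrix `E = u uᵀ` with `wᵀ E w = 1`
  set E : ι × ι → k := fun p => if p.1 = i₀ ∧ p.2 = i₀ then c ^ 2 else 0 with hE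
  have quadE : w ⬝ᵥ (Matrix.of fun i j => E (i, j)) *ᵥ w = 1 := by
    simp only [hE, dotProduct, mulVec, of_apply, ite_mul, zero_mul]
    rw [Finset.sum_eq_single i₀]
    · rw [Finset.sum_eq_single i₀]
      · simp only [and_self, if_true]
        rw [show w i₀ * (c ^ 2 * w i₀) = (w i₀ * c) * (w i₀ * c) by ring, hcw, one_mul]
      · intro j _ hj
        simp [hj]
      · simp
    · intro i _ hi
      simp [hi]
    · simp
  -- linearity of `V ↦ wᵀ V w` in the form we need
  have quad_sub : ∀ (V : ι × ι → k) (t : k),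
      w ⬝ᵥ (Matrix.of fun i j => (V - t • E) (i, j)) *ᵥ w =
        w ⬝ᵥ (Matrix.of fun i j => V (i, j)) *ᵥ w -
          t * (w ⬝ᵥ (Matrix.of fun i j => E (i, j)) *ᵥ w) := by
    intro V t
    have : (Matrix.of fun i j => (V - t • E) (i, j)) =
        (Matrix.of fun i j => V (i, j)) - t • Matrix.of fun i j => E (i, j) := by
      ext i j
      simp
    rw [this, sub_mulVec, dotProduct_sub, smul_mulVec, dotProduct_smul, smul_eq_mul]
  -- columns of `L`, the two vectors of the rank-one correction
  set ℓ : σ → ι × ι → k := fun v p => L p v with hℓ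
  set a : σ → k := fun v => (ℓ v - R *ᵥ ℓ v) ⬝ᵥ H *ᵥ E with ha
  set b : σ → k := fun v => w ⬝ᵥ (Matrix.of fun i j => ℓ v (i, j)) *ᵥ w with hb
  set O : Matrix σ σ k :=
    (Matrix.of fun (v : σ) (_ : Unit) => a v) * Matrix.of fun (_ : Unit) (v' : σ) => b v' with hO
  have hOr : O.rank ≤ 1 := by
    refine (rank_mul_le_right _ _).trans ?_
    simpa using rank_le_card_height (Matrix.of fun (_ : Unit) (v' : σ) => b v')
  have key : Lᵀ * H * L = (R * L)ᵀ * H * L + O := by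
    ext v v'
    rw [Matrix.add_apply, Summit.ValiantsHypothesis.Theorems.transpose_mul_mul_apply,
      Summit.ValiantsHypothesis.Theorems.transpose_mul_mul_apply]
    have hO' : O v v' = a v * b v' := by
      simp [hO, Matrix.mul_apply]
    rw [hO']
    have hRL : (fun p => (R * L) p v) = R *ᵥ ℓ v := by
      funext p
      simp only [Matrix.mul_apply, mulVec, dotProduct, hℓ]
    rw [hRL]
    -- the two-sided orthogonal part of column `v` and the corner-free part of column `v'`
    have hZsymm : ∀ i j, (ℓ v - R *ᵥ ℓ v) (j, i) = (ℓ v - R *ᵥ ℓ v) (i, j) := by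
      intro i j
      simp only [Pi.sub_apply, hℓ, hL i j v, hRsymm]
    have h1 : w ᵥ* (Matrix.of fun i j => (ℓ v - R *ᵥ ℓ v) (i, j)) = 0 := by
      have : (Matrix.of fun i j => (ℓ v - R *ᵥ ℓ v) (i, j)) =
          (Matrix.of fun i j => ℓ v (i, j)) - Matrix.of fun i j => (R *ᵥ ℓ v) (i, j) := by
        ext i j
        simp
      rw [this, vecMul_sub, hRw, sub_self]
    have h2 : (Matrix.of fun i j => (ℓ v - R *ᵥ ℓ v) (i, j)) *ᵥ w = 0 := by
      have hT : (Matrix.of fun i j => (ℓ v - R *ᵥ ℓ v) (i, j))ᵀ =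
          Matrix.of fun i j => (ℓ v - R *ᵥ ℓ v) (i, j) := by
        ext i j
        simp only [transpose_apply, of_apply]
        exact hZsymm i j
      rw [← hT, mulVec_transpose, h1]
    have h3 : w ⬝ᵥ (Matrix.of fun i j => (ℓ v' - b v' • E) (i, j)) *ᵥ w = 0 := by
      rw [quad_sub, quadE, mul_one]
      exact sub_self _
    have h0 := hH (ℓ v - R *ᵥ ℓ v) (ℓ v' - b v' • E) h1 h2 h3
    rw [mulVec_sub, dotProduct_sub, mulVec_smul, dotProduct_smul, smul_eq_mul] at h0
    have hav : (ℓ v - R *ᵥ ℓ v) ⬝ᵥ H *ᵥ E = a v := rfl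
    rw [hav, sub_dotProduct] at h0
    linear_combination h0
  calc (Lᵀ * H * L).rank = ((R * L)ᵀ * H * L + O).rank := by rw [← key]
    _ ≤ ((R * L)ᵀ * H * L).rank + O.rank :=
        Literature.Computability.AlgebraicComplexity.rank_add_le _ _
    _ ≤ (R * L)ᵀ.rank + 1 :=
        add_le_add ((rank_mul_le_left _ _).trans (rank_mul_le_left _ _)) hOr
    _ = (R * L).rank + 1 := by rw [rank_transpose]
    _ = (S * (P * L)).rank + 1 := by rw [hR, Matrix.mul_assoc]
    _ ≤ (P * L).rank + 1 := by gcongr; exact rank_mul_le_right _ _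

end Abstract

end Summit.ValiantsHypothesis.ValiantsHypothesis.Theorems.SymPencilKernelRowRank

end
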